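import Mathlib

/-!
# KunnethProjector — the Künneth projectors are polynomials in `[n]^*` (Tier 4, T4-A)

Seat p3 of the blind cell `pub-hodge-repro2` (Tier 4, README §6).  Nothing here depends on any
other file of the cell.

The bridge argument of T4-A projects the algebraic class `f_*[S]` (and its dual partner) onto the
Weil line `W_𝐅(B) ⊂ H¹(A₁) ⊗ H¹(A₂) ⊗ H¹(A₃) ⊗ H¹(A₄) ⊂ H⁴(B, ℚ)` by ALGEBRAIC correspondences
(the hypotheses `proj_alg` / `projT_alg` of `PairingTransfer.TransferData`).  The first factor of
that projector is the Künneth projector `π¹_{A_i}` of each CM threefold: on an abelian variety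
`A` of dimension `g` the multiplication-by-`n` endomorphism `[n]` acts on `H^k(A, ℚ)` by `n^k`
(`H^k = ⋀^k H¹` and `[n]^* = n` on `H¹`), so `H^*(A, ℚ) = ⊕_{k=0}^{2g} H^k(A, ℚ)` is the
eigen-decomposition of `[n]^*` for the `2g + 1` DISTINCT eigenvalues `n^0, …, n^{2g}` (`n ⩾ 2`),
and the projector onto `H^k` is the Lagrange interpolation polynomial `P_k([n]^*)`,
`P_k(X) = ∏_{j ≠ k} (X − n^j)/(n^k − n^j)` — a ℚ-linear combination of powers of the class of
the graph of `[n]`, hence an algebraic correspondence (Lieberman 1968 / Kleiman 1968: the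
Künneth components of the diagonal of an abelian variety are algebraic; Deninger–Murre 1991).

This file proves that linear-algebra statement in the kernel:

* `kunnethPolynomial n d k` is the Lagrange polynomial with `P_k(n^k) = 1`, `P_k(n^j) = 0` for
  `j ≠ k`, `j ⩽ d` (`eval_kunnethPolynomial_self`, `eval_kunnethPolynomial_of_ne`);
* for an endomorphism `N` of a ℚ-vector space `V` and a vector `v` with `N v = n^j • v`,
  `P_k(N) v = v` if `j = k` and `= 0` otherwise (`aeval_kunnethPolynomial_of_apply_eq_smul`);
* `P_k(N)` lies in the ℚ-subalgebra generated by `N` (`kunnethOperator_mem_adjoin`) — read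
  with `N = [n]^*`: the Künneth projector is a polynomial in the graph of `[n]`;
* if `V` is spanned by the eigen-pieces (the Künneth decomposition), `P_k(N)` is idempotent, its
  range is the `n^k`-eigenspace, and it kills the other pieces (`kunnethOperator_idem`,
  `range_kunnethOperator`) — i.e. it IS the projector onto `H^k`.

Axioms: propext, Classical.choice, Quot.sound.
-/

namespace Summit.Ventures.HodgeRepro2.KunnethProjector

open Polynomial Module

/-- The node `j ↦ n^j` of the Lagrange interpolation, as a rational number. -/
def node (n j : ℕ) : ℚ := (n : ℚ) ^ j

/-- For `n ⩾ 2` the nodes `n^0, n^1, …` are pairwise distinct. -/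
theorem node_injective {n : ℕ} (hn : 2 ≤ n) : Function.Injective (node n) := by
  intro i j hij
  have h₀ : (0 : ℚ) < n := by exact_mod_cast (by omega : 0 < n)
  have h₁ : (n : ℚ) ≠ 1 := by exact_mod_cast (by omega : n ≠ 1)
  exact pow_right_injective₀ h₀ h₁ hij

/-- The Künneth polynomial `P_k(X) = ∏_{j ⩽ d, j ≠ k} (X − n^j)/(n^k − n^j)`: the Lagrange basis
polynomial at the node `n^k` among the nodes `n^0, …, n^d` (`d = 2g`). -/
noncomputable def kunnethPolynomial (n d k : ℕ) : ℚ[X] :=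
  Lagrange.basis (Finset.range (d + 1)) (node n) k

/-- `P_k(n^k) = 1`. -/
theorem eval_kunnethPolynomial_self {n : ℕ} (hn : 2 ≤ n) {d k : ℕ} (hk : k ≤ d) :
    (kunnethPolynomial n d k).eval (node n k) = 1 := by
  unfold kunnethPolynomial
  exact Lagrange.eval_basis_self (node_injective hn).injOn
    (Finset.mem_range.mpr (by omega))

/-- `P_k(n^j) = 0` for `j ≠ k`, `j ⩽ d`. -/
theorem eval_kunnethPolynomial_of_ne {n d k j : ℕ} (hj : j ≤ d) (hjk : j ≠ k) :
    (kunnethPolynomial n d k).eval (node n j) = 0 := by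
  unfold kunnethPolynomial
  exact Lagrange.eval_basis_of_ne (Ne.symm hjk) (Finset.mem_range.mpr (by omega))

variable {V : Type*} [AddCommGroup V] [Module ℚ V]

/-- The Künneth operator `P_k(N)` of an endomorphism `N` (to be read with `N = [n]^*`). -/
noncomputable def kunnethOperator (N : V →ₗ[ℚ] V) (n d k : ℕ) : V →ₗ[ℚ] V :=
  aeval N (kunnethPolynomial n d k)

/-- On an `n^j`-eigenvector of `N`, the Künneth operator `P_k(N)` is the identity if `j = k` and
zero otherwise. -/
theorem kunnethOperator_apply_of_apply_eq_smul (N : V →ₗ[ℚ] V) {n : ℕ} (hn : 2 ≤ n) {d k j : ℕ}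
    (hk : k ≤ d) (hj : j ≤ d) {v : V} (hv : N v = node n j • v) :
    kunnethOperator N n d k v = if j = k then v else 0 := by
  unfold kunnethOperator
  rw [Module.End.aeval_apply_of_mem_apply_eq_smul hv]
  by_cases hjk : j = k
  · subst hjk
    rw [if_pos rfl, eval_kunnethPolynomial_self hn hk, one_smul]
  · rw [if_neg hjk, eval_kunnethPolynomial_of_ne hj hjk, zero_smul]

/-- ALGEBRAICITY: the Künneth operator lies in the ℚ-subalgebra generated by `N`.  With
`N = [n]^*` (the cohomology action of the graph of multiplication by `n`, an algebraic
correspondence) this is the statement that the Künneth projector is an algebraic correspondence: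
a ℚ-linear combination of powers of the graph of `[n]`. -/
theorem kunnethOperator_mem_adjoin (N : V →ₗ[ℚ] V) (n d k : ℕ) :
    kunnethOperator N n d k ∈ Algebra.adjoin ℚ ({N} : Set (V →ₗ[ℚ] V)) :=
  Polynomial.aeval_mem_adjoin_singleton ℚ N

/-- THE KÜNNETH DECOMPOSITION as a hypothesis: every vector is a sum of `n^j`-eigenvectors of
`N`, `j = 0, …, d` (for `N = [n]^*` on `H^*(A, ℚ)`: `H^* = ⊕_{j=0}^{2g} H^j`). -/
def IsKunnethDecomposition (N : V →ₗ[ℚ] V) (n d : ℕ) : Prop :=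
  ∀ v : V, ∃ c : ℕ → V, (∀ j, j ≤ d → N (c j) = node n j • c j) ∧
    v = ∑ j ∈ Finset.range (d + 1), c j

/-- Under the Künneth decomposition, `P_k(N) v` is the `k`-th component of `v`. -/
theorem kunnethOperator_apply_eq_component (N : V →ₗ[ℚ] V) {n : ℕ} (hn : 2 ≤ n) {d k : ℕ}
    (hk : k ≤ d) (c : ℕ → V) (hc : ∀ j, j ≤ d → N (c j) = node n j • c j) :
    kunnethOperator N n d k (∑ j ∈ Finset.range (d + 1), c j) = c k := by
  rw [map_sum]
  rw [Finset.sum_eq_single k]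
  · rw [kunnethOperator_apply_of_apply_eq_smul N hn hk hk (hc k hk), if_pos rfl]
  · intro j hj hjk
    rw [kunnethOperator_apply_of_apply_eq_smul N hn hk (by
      have := Finset.mem_range.mp hj; omega) (hc j (by have := Finset.mem_range.mp hj; omega)),
      if_neg hjk]
  · intro hkr
    exact absurd (Finset.mem_range.mpr (by omega)) hkr

/-- Under the Künneth decomposition the Künneth operator is an eigenvector producer:
`N (P_k(N) v) = n^k • P_k(N) v`. -/
theorem apply_kunnethOperator (N : V →ₗ[ℚ] V) {n : ℕ} (hn : 2 ≤ n) {d k : ℕ} (hk : k ≤ d)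
    (hdec : IsKunnethDecomposition N n d) (v : V) :
    N (kunnethOperator N n d k v) = node n k • kunnethOperator N n d k v := by
  obtain ⟨c, hc, rfl⟩ := hdec v
  rw [kunnethOperator_apply_eq_component N hn hk c hc]
  exact hc k hk

/-- IDEMPOTENCE: under the Künneth decomposition, `P_k(N)` is a projector. -/
theorem kunnethOperator_idem (N : V →ₗ[ℚ] V) {n : ℕ} (hn : 2 ≤ n) {d k : ℕ} (hk : k ≤ d)
    (hdec : IsKunnethDecomposition N n d) (v : V) :
    kunnethOperator N n d k (kunnethOperator N n d k v) = kunnethOperator N n d k v := by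
  rw [kunnethOperator_apply_of_apply_eq_smul N hn hk hk (apply_kunnethOperator N hn hk hdec v),
    if_pos rfl]

/-- THE RANGE: under the Künneth decomposition, the range of `P_k(N)` is exactly the
`n^k`-eigenspace of `N` — for `N = [n]^*`, the degree-`k` cohomology `H^k(A, ℚ)`. -/
theorem range_kunnethOperator (N : V →ₗ[ℚ] V) {n : ℕ} (hn : 2 ≤ n) {d k : ℕ} (hk : k ≤ d)
    (hdec : IsKunnethDecomposition N n d) :
    LinearMap.range (kunnethOperator N n d k) = Module.End.eigenspace N (node n k) := by
  ext v
  constructor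
  · rintro ⟨w, rfl⟩
    exact Module.End.mem_eigenspace_iff.mpr (apply_kunnethOperator N hn hk hdec w)
  · intro hv
    have hv' := Module.End.mem_eigenspace_iff.mp hv
    refine ⟨v, ?_⟩
    rw [kunnethOperator_apply_of_apply_eq_smul N hn hk hk hv', if_pos rfl]

/-- The Künneth operators kill each other's pieces: `P_k(N) ∘ P_l(N) = 0` for `k ≠ l`. -/
theorem kunnethOperator_comp_of_ne (N : V →ₗ[ℚ] V) {n : ℕ} (hn : 2 ≤ n) {d k l : ℕ}
    (hk : k ≤ d) (hl : l ≤ d) (hkl : k ≠ l) (hdec : IsKunnethDecomposition N n d) (v : V) :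
    kunnethOperator N n d k (kunnethOperator N n d l v) = 0 := by
  rw [kunnethOperator_apply_of_apply_eq_smul N hn hk hl (apply_kunnethOperator N hn hl hdec v),
    if_neg (Ne.symm hkl)]

/-- The Künneth operators sum to the identity under the Künneth decomposition:
`∑_{k ⩽ d} P_k(N) v = v` (the decomposition of the diagonal into its Künneth components). -/
theorem sum_kunnethOperator (N : V →ₗ[ℚ] V) {n : ℕ} (hn : 2 ≤ n) {d : ℕ}
    (hdec : IsKunnethDecomposition N n d) (v : V) :
    ∑ k ∈ Finset.range (d + 1), kunnethOperator N n d k v = v := by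
  obtain ⟨c, hc, rfl⟩ := hdec v
  refine Finset.sum_congr rfl fun k hk => ?_
  exact kunnethOperator_apply_eq_component N hn (by have := Finset.mem_range.mp hk; omega) c hc

end Summit.Ventures.HodgeRepro2.KunnethProjector
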